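import Literature.AlgebraicGeometry.Motives.GrassmannianOfLinesPointCount
import HarnessLib

/-!
# The zeta function of the Grassmannian of lines over a finite field:
# `Z(G(1, ℙⁿ⁺¹_{𝔽_q}), T) = ∏_{n ≥ a ≥ b ≥ 0} (1 − q^{a+b}T)⁻¹ = ∏_{r=0}^{2n} (1 − qʳT)^{−(⌊min(r,2n−r)/2⌋+1)}`

Topic `Literature/AlgebraicGeometry/Motives`; THEOREMS ONLY (no definition, no instance, no named fact;
D-0026).  Sequel to `Motives/GrassmannianOfLinesPointCount` (`#G(1, ℙⁿ⁺¹)(𝔽_{q^m}) = Σ_{a ≤ n} Σ_{b ≤ a}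
q^{m(a+b)} = Σ_{r ≤ 2n} (⌊min(r, 2n−r)/2⌋ + 1) q^{mr}`, Weil 1949 p. 508).  With the tree's
`zetaSeries X = exp(Σ_m N_m Tᵐ/m)` (`Motives/ZetaFunction`), `Dwork.zetaSeries_eq_countZeta`,
`Dwork.countZeta_sum` (`Z_{Σ Nᵢ} = ∏ Z_{Nᵢ}`) and `Dwork.countZeta_pow_mul` (`exp(Σ_m aᵐTᵐ/m)·(1 − aT) = 1`)
the zeta function of the Grassmannian of lines is the product of the zeta functions of its cells.

## Sources, read on the page

A. Weil, *Numbers of solutions of equations in finite fields* [Weil1949], p. 507: «`Σ₁^∞ N_ν U^{ν−1} =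
d/dU log Z(U)`, where `Z(U)` is a rational function in `U` … `Z(U) = P₁(U)P₃(U)⋯P_{2n−1}(U)/(P₀(U)P₂(U)⋯P_{2n}(U))`»,
p. 508: the Grassmann variety `G_{m,r}` has `F(q)` rational points, `F(X) = (X^{m+1} − 1)⋯(X^{m+1} − Xʳ)/
((X^{r+1} − 1)⋯(X^{r+1} − Xʳ))`, «Then, if the above conjectures are true, the Poincaré polynomial of the
Grassmann variety `G_{m,r}` over complex numbers must be `F(X²)`. This is indeed so … Ehresmann».
B. Kahn, *Zeta and L-functions of varieties and motives* [Kahn2020], §3.3 p. 47: «The case of Grassmannian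
varieties now seems easy, insofar as they are cellular»; Prop. 2.3 (5) (`Z(X × 𝔸ⁿ, T) = Z(X, qⁿT)`) and §1
(`Z(X, T) = Z(Y, T)·Z(X − Y, T)` for `Y` closed).
N. Ramachandran, *Zeta functions, Grothendieck groups, and the Witt ring* [Ramachandran2014], §2 Remark 2.2:
`Z(𝔸ⁿ, t) = [qⁿ] = 1/(1 − qⁿt)` in `W(ℤ)` and `Z` is additive on decompositions (Witt sum = product of power
series).
R. Hartshorne, *Algebraic Geometry* [Hartshorne1977], App. C §1 («In particular, it is a rational function»).
G. E. Andrews, *The Theory of Partitions* [Andrews1976Partitions], Thm. 3.1 (`[n+2; 2] = Σ_r p(n, 2, r) qʳ`).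

## What is here (`k` finite, `q = #k`; `G = grassmannianOfLines (n+1) k = G(1, ℙⁿ⁺¹) = G(2, n+2)`)

* §1 (pure) `Dwork.countZeta_nsmul` (`Z_{c·N} = Z_N^c`, `c ∈ ℕ`).
* §2 **`zetaSeries_grassmannianOfLines_eq_prod_prod_countZeta`** (`Z(G, T) = ∏_{a ≤ n} ∏_{b ≤ a}
  exp(Σ_m q^{(a+b)m}Tᵐ/m)`), **`zetaSeries_grassmannianOfLines_mul_prod_prod`** (`Z(G, T) · ∏_{a ≤ n} ∏_{b ≤ a}
  (1 − q^{a+b}T) = 1` — one factor `1/(1 − q^{a+b}T) = Z(𝔸^{a+b}, T)` per Schubert cell), the cellular reading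
  **`zetaSeries_grassmannianOfLines_eq_prod_prod_zetaSeries_affineSpace`** (`Z(G, T) = ∏_{a ≤ n} ∏_{b ≤ a}
  Z(𝔸^{a+b}_{𝔽_q}, T)`, Ramachandran's Witt sum), and grouped by dimension
  **`zetaSeries_grassmannianOfLines_mul_prod_pow`** (`Z(G, T) · ∏_{r ≤ 2n} (1 − qʳT)^{⌊min(r,2n−r)/2⌋+1} = 1`:
  the shape `∏ P_{2r}^{−1}`, `P_{2r} = (1 − qʳT)^{b_{2r}}`, of Weil's conjectured factorisation, here a theorem),
  `zetaSeries_grassmannianOfLines_eq_prod_countZeta_pow`.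
* §3 rationality and first cases: `exists_zetaSeries_grassmannianOfLines_mul_coe_eq_one` (`Z·B = 1` with
  `B ∈ ℚ[T]`, `B(0) = 1`, `deg B = binom(n+2, 2) = χ(G)`), `zetaSeries_grassmannianOfLines_one_mul`
  (`G(1, ℙ¹) = pt`: `Z·(1 − T) = 1`), `zetaSeries_grassmannianOfLines_two_eq` (`Z(G(1, ℙ²)) = Z(ℙ²)`),
  `zetaSeries_grassmannianOfLines_three_mul` (`G(1, ℙ³)`: `Z·(1−T)(1−qT)(1−q²T)²(1−q³T)(1−q⁴T) = 1`).

What is NOT here: the Weil factorisation `IsWeilFactorization` with its Riemann-hypothesis clause, Betti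
numbers and functional equation (the sequel `Motives/WeilConjecturesForGrassmannianOfLines`); the Schubert cells
as subschemes.  HC is not touched.

## References

* [Weil1949] A. Weil, *Numbers of solutions of equations in finite fields*, Bull. AMS 55 (1949), pp. 507–508.
* [Kahn2020] B. Kahn, *Zeta and L-functions of varieties and motives*, LMS LN 462 (2020), §1, Prop. 2.3, §3.3.
* [Ramachandran2014] N. Ramachandran, *Zeta functions, Grothendieck groups, and the Witt ring*, Bull. Sci.
  Math. 139 (2015), §2 Remark 2.2.
* [Hartshorne1977] R. Hartshorne, *Algebraic Geometry*, GTM 52, App. C §1.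
* [Andrews1976Partitions] G. E. Andrews, *The Theory of Partitions* (1976), §3.2 Thm. 3.1.
* [Koblitz1984] N. Koblitz, *p-adic Numbers, p-adic Analysis, and Zeta-Functions*, Ch. V §1 (`exp(Σ aˢTˢ/s) =
  1/(1 − aT)`).

## Provenance

Lane `lit-hodgefound` (summit `HodgeConjecture`, Track 2 foundations library, Layer B: motives / zeta
functions), seat `lit-hodgefound-p29` (literature-prover, generation 51, row g51-#3).
-/

universe u

open CategoryTheory AlgebraicGeometry Function Finset
open Literature.NumberTheory.Transcendental (affineSpaceOver)
open Literature.NumberTheory.LFunctions.Dwork (countZeta countZeta_congr countZeta_pow_mul countZeta_sum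
  countZeta_add countZeta_zero zetaSeries_eq_countZeta)
open Literature.Combinatorics.Enumerative.GaussianBinomialTwoRows

noncomputable section

/-! ### §1 `Z_{c·N} = Z_N^c` -/

namespace Literature.NumberTheory.LFunctions.Dwork

/-- `exp(Σ_m (c·N_m) Tᵐ/m) = exp(Σ_m N_m Tᵐ/m)^c` for `c ∈ ℕ` (`countZeta_add` iterated): `c` cells of the
same dimension contribute the `c`-th power. [cite: Koblitz1984, Ch. V §1] -/
theorem countZeta_nsmul (c : ℕ) (N : ℕ → ℤ) : countZeta (c • N) = countZeta N ^ c := by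
  induction c with
  | zero => rw [zero_smul, pow_zero, countZeta_zero]
  | succ c ih => rw [succ_nsmul, countZeta_add, ih, pow_succ]

end Literature.NumberTheory.LFunctions.Dwork

open Literature.NumberTheory.LFunctions.Dwork (countZeta_nsmul)

namespace Literature.AlgebraicGeometry.Motives

section Zeta

variable {k : Type u} [Field k] [Finite k] {n : ℕ}

/-! ### §2 `Z(G(1, ℙⁿ⁺¹), T)` as a product over the cells -/

/-- **`Z(G(1, ℙⁿ⁺¹_{𝔽_q}), T) = ∏_{a ≤ n} ∏_{b ≤ a} exp(Σ_{m ≥ 1} (q^{a+b})ᵐ Tᵐ/m)`**: the cellular count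
`N_m = Σ_{a ≤ n} Σ_{b ≤ a} q^{m(a+b)}` exponentiated (`Dwork.countZeta_sum` twice).
[cite: Weil1949, p. 508] [cite: Kahn2020, §3.3] -/
theorem zetaSeries_grassmannianOfLines_eq_prod_prod_countZeta :
    zetaSeries (grassmannianOfLines (n + 1) k) =
      ∏ a ∈ range (n + 1), ∏ b ∈ range (a + 1), countZeta (fun m => ((Nat.card k : ℤ) ^ (a + b)) ^ m) := by
  rw [zetaSeries_eq_countZeta]
  simp_rw [← countZeta_sum]
  refine countZeta_congr fun m hm => ?_
  rw [pointCount_grassmannianOfLines_eq_sum_sum hm, Finset.sum_apply, Nat.cast_sum]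
  refine sum_congr rfl fun a _ => ?_
  rw [Finset.sum_apply, Nat.cast_sum]
  refine sum_congr rfl fun b _ => ?_
  rw [Nat.cast_pow, ← pow_mul, mul_comm]

/-- **`Z(G(1, ℙⁿ⁺¹_{𝔽_q}), T) · ∏_{a ≤ n} ∏_{b ≤ a} (1 − q^{a+b}T) = 1`** — the zeta function of the
Grassmannian of lines is `∏_{n ≥ a ≥ b ≥ 0} (1 − q^{a+b}T)⁻¹`, one factor for each Schubert cell `𝔸^{a+b}`
(Weil's `F`, Kahn's «cellular»; `Dwork.countZeta_pow_mul`). [cite: Weil1949, p. 508] [cite: Kahn2020, §3.3] -/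
theorem zetaSeries_grassmannianOfLines_mul_prod_prod :
    zetaSeries (grassmannianOfLines (n + 1) k) * ∏ a ∈ range (n + 1), ∏ b ∈ range (a + 1),
      ((1 - Polynomial.C ((Nat.card k : ℚ) ^ (a + b)) * Polynomial.X : Polynomial ℚ) : PowerSeries ℚ) = 1 := by
  rw [zetaSeries_grassmannianOfLines_eq_prod_prod_countZeta, ← prod_mul_distrib]
  refine prod_eq_one fun a _ => ?_
  rw [← prod_mul_distrib]
  refine prod_eq_one fun b _ => ?_
  have h := countZeta_pow_mul ((Nat.card k : ℤ) ^ (a + b))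
  rw [Int.cast_pow, Int.cast_natCast] at h
  exact h

/-- **Ramachandran's Witt-sum ∕ Kahn's cellular reading: `Z(G(1, ℙⁿ⁺¹_{𝔽_q}), T) = ∏_{a ≤ n} ∏_{b ≤ a}
Z(𝔸^{a+b}_{𝔽_q}, T)`** — the zeta function of the Grassmannian of lines is the product of the zeta functions
of its Schubert cells (`Z(𝔸ᵈ, T) = 1/(1 − qᵈT)`; the tree's `affineSpaceOver σ k` with `#σ = a + b`, index type
`Fin (a+b)` lifted to the universe of `k`). [cite: Ramachandran2014, §2 Remark 2.2] [cite: Kahn2020, §1 and §3.3] -/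
theorem zetaSeries_grassmannianOfLines_eq_prod_prod_zetaSeries_affineSpace :
    zetaSeries (grassmannianOfLines (n + 1) k) =
      ∏ a ∈ range (n + 1), ∏ b ∈ range (a + 1), zetaSeries (affineSpaceOver (ULift.{u} (Fin (a + b))) k) := by
  rw [zetaSeries_grassmannianOfLines_eq_prod_prod_countZeta]
  refine prod_congr rfl fun a _ => prod_congr rfl fun b _ => ?_
  rw [zetaSeries_eq_countZeta]
  refine countZeta_congr fun m hm => ?_
  rw [pointCount_affineSpaceOver hm, Nat.card_ulift, Nat.card_fin, Nat.cast_pow, ← pow_mul, mul_comm]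

/-- `Z(G(1, ℙⁿ⁺¹_{𝔽_q}), T) = ∏_{r ≤ 2n} exp(Σ_m (qʳ)ᵐTᵐ/m)^{⌊min(r,2n−r)/2⌋+1}` — grouped by the dimension `r`
of the cells, `⌊min(r, 2n−r)/2⌋ + 1` of each (Andrews Thm. 3.1 at `M = 2`).
[cite: Weil1949, p. 508] [cite: Andrews1976Partitions, §3.2 Thm. 3.1] -/
theorem zetaSeries_grassmannianOfLines_eq_prod_countZeta_pow :
    zetaSeries (grassmannianOfLines (n + 1) k) =
      ∏ r ∈ range (2 * n + 1),
        countZeta (fun m => ((Nat.card k : ℤ) ^ r) ^ m) ^ (min r (2 * n - r) / 2 + 1) := by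
  rw [zetaSeries_eq_countZeta]
  simp_rw [← countZeta_nsmul, ← countZeta_sum]
  refine countZeta_congr fun m hm => ?_
  rw [pointCount_grassmannianOfLines_eq_sum_closed hm, Finset.sum_apply, Nat.cast_sum]
  refine sum_congr rfl fun r _ => ?_
  simp only [Pi.smul_apply, nsmul_eq_mul, Nat.cast_mul, Nat.cast_pow, ← pow_mul, mul_comm m r]

/-- **`Z(G(1, ℙⁿ⁺¹_{𝔽_q}), T) · ∏_{r=0}^{2n} (1 − qʳT)^{⌊min(r,2n−r)/2⌋+1} = 1`** — Weil's conjectured shape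
`Z = ∏_h P_h^{(−1)^{h+1}}` with `P_{2r} = (1 − qʳT)^{B_{2r}}`, `P_{odd} = 1` and `B_{2r} = ⌊min(r,2n−r)/2⌋ + 1`
the coefficient of `X^{2r}` in `F(X²) = [n+2; 2]_{X²}` («the Poincaré polynomial … must be `F(X²)`»), for the
Grassmannian of lines a THEOREM. [cite: Weil1949, pp. 507–508] -/
theorem zetaSeries_grassmannianOfLines_mul_prod_pow :
    zetaSeries (grassmannianOfLines (n + 1) k) * ∏ r ∈ range (2 * n + 1),
      ((1 - Polynomial.C ((Nat.card k : ℚ) ^ r) * Polynomial.X : Polynomial ℚ) : PowerSeries ℚ) ^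
        (min r (2 * n - r) / 2 + 1) = 1 := by
  rw [zetaSeries_grassmannianOfLines_eq_prod_countZeta_pow, ← prod_mul_distrib]
  refine prod_eq_one fun r _ => ?_
  rw [← mul_pow]
  have h := countZeta_pow_mul ((Nat.card k : ℤ) ^ r)
  rw [Int.cast_pow, Int.cast_natCast] at h
  rw [h, one_pow]

/-- The same with the polynomial `∏_{r ≤ 2n} (1 − qʳT)^{c(n,r)} ∈ ℚ[T]` coerced as a whole.
[cite: Weil1949, pp. 507–508] -/
theorem zetaSeries_grassmannianOfLines_mul_coe_prod_pow :
    zetaSeries (grassmannianOfLines (n + 1) k) * ((∏ r ∈ range (2 * n + 1),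
      (1 - Polynomial.C ((Nat.card k : ℚ) ^ r) * Polynomial.X) ^ (min r (2 * n - r) / 2 + 1) :
        Polynomial ℚ) : PowerSeries ℚ) = 1 := by
  -- the cast identity is isolated so that `rw` does not scan `zetaSeries (grassmannianOfLines …)`
  have hc : (((∏ r ∈ range (2 * n + 1),
      (1 - Polynomial.C ((Nat.card k : ℚ) ^ r) * Polynomial.X) ^ (min r (2 * n - r) / 2 + 1) :
        Polynomial ℚ)) : PowerSeries ℚ) =
      ∏ r ∈ range (2 * n + 1), (((1 - Polynomial.C ((Nat.card k : ℚ) ^ r) * Polynomial.X :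
        Polynomial ℚ)) : PowerSeries ℚ) ^ (min r (2 * n - r) / 2 + 1) := by
    rw [← Polynomial.coeToPowerSeries.ringHom_apply, map_prod]
    simp_rw [map_pow, Polynomial.coeToPowerSeries.ringHom_apply]
  rw [hc]
  exact zetaSeries_grassmannianOfLines_mul_prod_pow

/-! ### §3 Rationality and the first Grassmannians -/

/-- **`Z(G(1, ℙⁿ⁺¹_{𝔽_q}), T)` is a rational function** (Weil p. 507, Hartshorne App. C §1): `Z · B = 1` for a
polynomial `B ∈ ℚ[T]` with `B(0) = 1` and `deg B = binom(n+2, 2)` (`= Σ_r b_{2r} = χ(G(2, n+2))`, the number of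
Schubert cells). [cite: Weil1949, p. 507] [cite: Hartshorne1977, App. C §1] -/
theorem exists_zetaSeries_grassmannianOfLines_mul_coe_eq_one :
    ∃ B : Polynomial ℚ, B.coeff 0 = 1 ∧ B.natDegree = (n + 2).choose 2 ∧
      zetaSeries (grassmannianOfLines (n + 1) k) * (B : PowerSeries ℚ) = 1 := by
  refine ⟨∏ r ∈ range (2 * n + 1),
    (1 - Polynomial.C ((Nat.card k : ℚ) ^ r) * Polynomial.X) ^ (min r (2 * n - r) / 2 + 1), ?_, ?_,
    zetaSeries_grassmannianOfLines_mul_coe_prod_pow⟩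
  · rw [Polynomial.coeff_zero_eq_eval_zero, Polynomial.eval_prod]
    exact prod_eq_one fun r _ => by simp
  · have hq : ∀ r : ℕ, ((Nat.card k : ℚ) ^ r) ≠ 0 := fun r =>
      pow_ne_zero _ (Nat.cast_ne_zero.mpr Nat.card_pos.ne')
    have hlin : ∀ r : ℕ, (1 - Polynomial.C ((Nat.card k : ℚ) ^ r) * Polynomial.X : Polynomial ℚ).natDegree
        = 1 := fun r => by
      rw [sub_eq_add_neg, ← neg_mul, ← Polynomial.C_neg, add_comm, ← Polynomial.C_1]
      exact Polynomial.natDegree_linear (neg_ne_zero.mpr (hq r))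
    have hne : ∀ r ∈ range (2 * n + 1),
        ((1 - Polynomial.C ((Nat.card k : ℚ) ^ r) * Polynomial.X : Polynomial ℚ) ^
          (min r (2 * n - r) / 2 + 1)) ≠ 0 := fun r _ =>
      pow_ne_zero _ (Polynomial.ne_zero_of_natDegree_gt ((hlin r).symm ▸ Nat.zero_lt_one))
    rw [Polynomial.natDegree_prod _ _ hne, ← sum_coeff_two_eq_choose n]
    refine sum_congr rfl fun r _ => ?_
    rw [Polynomial.natDegree_pow, hlin, mul_one]

/-- `G(1, ℙ¹) = pt`: `Z(G(1, ℙ¹_{𝔽_q}), T)·(1 − T) = 1` (Ramachandran: `Z(Spec 𝔽_q, t) = (1 − t)⁻¹ = [1]`).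
[cite: Ramachandran2014, §2 Remark 2.2 (i)] -/
theorem zetaSeries_grassmannianOfLines_one_mul :
    zetaSeries (grassmannianOfLines 1 k) * ((1 - Polynomial.X : Polynomial ℚ) : PowerSeries ℚ) = 1 := by
  have h := zetaSeries_grassmannianOfLines_mul_prod_prod (n := 0) (k := k)
  rw [prod_range_one, prod_range_one, add_zero, pow_zero, map_one, one_mul] at h
  exact h

/-- `G(1, ℙ²) = ℙ²^∨`: `Z(G(1, ℙ²_{𝔽_q}), T) = Z(ℙ²_{𝔽_q}, T)` (equal point counts over every `𝔽_{q^m}`).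
[cite: Weil1949, p. 508] -/
theorem zetaSeries_grassmannianOfLines_two_eq :
    zetaSeries (grassmannianOfLines 2 k) = zetaSeries (projectiveSpace 2 k) := by
  rw [zetaSeries_eq_countZeta, zetaSeries_eq_countZeta]
  exact countZeta_congr fun m hm => by rw [(pointCount_grassmannianOfLines_two hm).2]

/-- `G(1, ℙ³)`, the Klein quadric: `Z(G(1, ℙ³_{𝔽_q}), T) · (1 − T)(1 − qT)(1 − q²T)²(1 − q³T)(1 − q⁴T) = 1`
(cells of dimensions `0, 1, 2, 2, 3, 4`; `b₄ = 2`). [cite: Weil1949, p. 508] -/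
theorem zetaSeries_grassmannianOfLines_three_mul :
    zetaSeries (grassmannianOfLines 3 k) *
      (((1 - Polynomial.X : Polynomial ℚ) : PowerSeries ℚ) *
        ((1 - Polynomial.C (Nat.card k : ℚ) * Polynomial.X : Polynomial ℚ) : PowerSeries ℚ) *
        ((1 - Polynomial.C ((Nat.card k : ℚ) ^ 2) * Polynomial.X : Polynomial ℚ) : PowerSeries ℚ) ^ 2 *
        ((1 - Polynomial.C ((Nat.card k : ℚ) ^ 3) * Polynomial.X : Polynomial ℚ) : PowerSeries ℚ) *
        ((1 - Polynomial.C ((Nat.card k : ℚ) ^ 4) * Polynomial.X : Polynomial ℚ) : PowerSeries ℚ)) = 1 := by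
  have h := zetaSeries_grassmannianOfLines_mul_prod_pow (n := 2) (k := k)
  simp only [prod_range_succ, prod_range_zero, one_mul, pow_zero, map_one, pow_one] at h
  norm_num at h ⊢
  linear_combination h

end Zeta

end Literature.AlgebraicGeometry.Motives
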